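import Summits.QuantumFields.GaugeBoot.DiagonalRPTorusTwoTwist
import Summits.QuantumFields.GaugeBoot.DiagonalRPTorusTwoOrbit
import Literature.MathematicalPhysics.QuantumFieldTheory.LatticeRPMechanism
import HarnessLib

/-!
# Diagonal RP on the two-dimensional torus, gauge-invariant sector, III: the untwisted crossing
couplings are a Gram kernel (gauge-boot, task L3(ε))

HONEST FRAMING (cell `pub-gaugeboot`, page 1 of every file): the venture produces certified bounds
on lattice expectations at stated coupling, gauge group, dimension and torus size; NOT a mass gap,
NOT a continuum limit, NOT a string tension; NOT Yang–Mills-summit-bearing (barriers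
`FixedCouplingUltralocality`, `PerturbativeInvisibility`). This module is part of a small POSITIVE
structural result about which positivity constraints a two-dimensional TORUS certificate may use;
it discharges nothing else.

With the twisted swap `Θ'` of `DiagonalRPTorusTwoTwist.lean` (`C_y(Θ'U) = D_y(U)` on the mirror
`k = 0`, `D_y(Θ'U) = C_y(U)` on the back layer `k = c`), the Boltzmann weight of the plaquettes of
the two crossing layers is a Gram kernel between `U` and `Θ'U`:
`β (Σ_{k(y)=0} r_y(U) + Σ_{k(y)=c} r_y(U)) = Σ_ι a_ι(U) conj a_ι(Θ'U)` (`gcoeff`,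
`sum_gcoeff_mul_conj`; `a_ι = √(β/2)` times a unitarised entry of the crossing transport `C_y` /
`D_y` or its conjugate, `CompactGroup.re_trace_mul_inv_eq_sum`; `β ≥ 0`), with the coefficient
functions bounded, measurable and supported on the closed half. Hence the tree's abstract
Osterwalder–Seiler lemma `LatticeRP.integral_mul_conj_mul_exp_nonneg` (with `Θ'`, positive
block = the links of the closed half, no spliced links) gives
**`integral_twisted_nonneg`**: `0 ≤ ∫ g(U) conj g(Θ'U) exp(Σ_ι a_ι(U) conj a_ι(Θ'U)) dU` for
`g = F · exp(β Σ_{0<k<c} r_y)` (`gObs`) and every bounded measurable closed-half observable `F`.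
This is the UNTWISTED half of the argument; `DiagonalRPTorusGaugeInvariantTwo.lean` removes the
twist for gauge-invariant `F`. All statements are proved. Reference for the mechanism:
K. Osterwalder, E. Seiler, Ann. Phys. 110 (1978) 440, §2.
-/

open MeasureTheory Complex Finset Function
open scoped ComplexOrder ENNReal

namespace Summit.QuantumFields.GaugeBoot

open Literature.MathematicalPhysics.QuantumFieldTheory
open Literature.RepresentationTheory.CompactGroups

noncomputable section

namespace DiagRPTwo

open Literature.RepresentationTheory.CompactGroups

/-! ## The Gram coefficients of one transport -/

section GTerm

variable {N : ℕ} {G : Type*} [Group G] [TopologicalSpace G] [IsTopologicalGroup G] [CompactSpace G]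
  (ρ : G →* Matrix (Fin N) (Fin N) ℂ)

/-- The coefficient attached to a group element `g` and an index `(a, b, s)`:
`√(β/2) σ(g)_{ab}` (`s = true`) or its conjugate (`s = false`), `σ` the unitarised `ρ`. -/
def gterm (hρ : Continuous ρ) (β : ℝ) (g : G) (k : Fin N × Fin N × Bool) : ℂ :=
  (Real.sqrt (β / 2) : ℂ) *
    (if k.2.2 then CompactGroup.unitarize ρ hρ g k.1 k.2.1
      else (starRingEnd ℂ) (CompactGroup.unitarize ρ hρ g k.1 k.2.1))

/-- **Gram form of the character kernel**: `Σ_k t_k(g) conj t_k(h) = β Re tr ρ(g h⁻¹)` (`β ≥ 0`). -/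
theorem sum_gterm_mul_conj (hρ : Continuous ρ) {β : ℝ} (hβ : 0 ≤ β) (g h : G) :
    ∑ k, gterm ρ hρ β g k * (starRingEnd ℂ) (gterm ρ hρ β h k) =
      ((β * ((ρ (g * h⁻¹)).trace).re : ℝ) : ℂ) := by
  have hs : (Real.sqrt (β / 2) : ℂ) * (Real.sqrt (β / 2) : ℂ) = ((β / 2 : ℝ) : ℂ) := by
    rw [← Complex.ofReal_mul, Real.mul_self_sqrt (by linarith)]
  rw [CompactGroup.re_trace_mul_inv_eq_sum ρ hρ, Finset.mul_sum, Complex.ofReal_sum,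
    Fintype.sum_prod_type]
  refine Finset.sum_congr rfl fun a _ => ?_
  rw [Finset.mul_sum, Complex.ofReal_sum, Fintype.sum_prod_type]
  refine Finset.sum_congr rfl fun b _ => ?_
  rw [Fintype.sum_bool]
  simp only [gterm, ↓reduceIte, Bool.false_eq_true, map_mul, Complex.conj_ofReal, Complex.conj_conj]
  set u := CompactGroup.unitarize ρ hρ g a b
  set v := CompactGroup.unitarize ρ hρ h a b
  calc (Real.sqrt (β / 2) : ℂ) * u * ((Real.sqrt (β / 2) : ℂ) * (starRingEnd ℂ) v) +
        (Real.sqrt (β / 2) : ℂ) * (starRingEnd ℂ) u * ((Real.sqrt (β / 2) : ℂ) * v)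
      = ((Real.sqrt (β / 2) : ℂ) * (Real.sqrt (β / 2) : ℂ)) *
          (u * (starRingEnd ℂ) v + (starRingEnd ℂ) (u * (starRingEnd ℂ) v)) := by
        simp only [map_mul, Complex.conj_conj]; ring
    _ = ((β * (u * (starRingEnd ℂ) v).re : ℝ) : ℂ) := by
        rw [hs, Complex.add_conj]; push_cast; ring

/-- The coefficients are bounded by `√(β/2)`. -/
theorem norm_gterm_le (hρ : Continuous ρ) (β : ℝ) (g : G) (k : Fin N × Fin N × Bool) :
    ‖gterm ρ hρ β g k‖ ≤ Real.sqrt (β / 2) := by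
  unfold gterm
  rw [norm_mul, Complex.norm_real, Real.norm_eq_abs, abs_of_nonneg (Real.sqrt_nonneg _)]
  refine mul_le_of_le_one_right (Real.sqrt_nonneg _) ?_
  split_ifs
  · exact CompactGroup.norm_unitarize_apply_le_one ρ hρ _ _ _
  · rw [Complex.norm_conj]; exact CompactGroup.norm_unitarize_apply_le_one ρ hρ _ _ _

variable [MeasurableSpace G] [BorelSpace G]

/-- The coefficients are measurable in the group element (jointly continuous, in fact). -/
theorem measurable_gterm (hρ : Continuous ρ) (β : ℝ) (k : Fin N × Fin N × Bool) :
    Measurable fun g : G => gterm ρ hρ β g k := by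
  have hc : Continuous fun g : G => CompactGroup.unitarize ρ hρ g k.1 k.2.1 :=
    (CompactGroup.continuous_unitarize ρ hρ).matrix_elem k.1 k.2.1
  unfold gterm
  split_ifs
  · exact measurable_const.mul hc.measurable
  · exact measurable_const.mul (Complex.continuous_conj.measurable.comp hc.measurable)

end GTerm

/-! ## The crossing transports -/

section CrossT

variable {L : ℕ} {G : Type*} [Group G]

/-- The crossing transport at `y`: `C_y` on the mirror `k = 0`, `D_y` otherwise (used on the back
layer `k = c`). -/
def crossT (i j : Fin 2) (U : GaugeConfig 2 L G) (y : Site 2 L) : G :=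
  if kd i j y = 0 then cT i j U y else dT i j U y

/-- The crossing transport at a mirror or back-layer site reads only links of the closed half. -/
theorem dependsOn_crossT [NeZero L] (h4 : 4 ≤ L) {i j : Fin 2} (hij : i ≠ j) {y : Site 2 L}
    (hy : kd i j y = 0 ∨ kd i j y = cc L) :
    DependsOn (fun U : GaugeConfig 2 L G => crossT i j U y) (halfLinks (L := L) i j : Set (Edge 2 L)) := by
  intro U V hUV
  have hUV' : ∀ e, InHalf i j e → U e = V e := fun e he => hUV e (Finset.mem_coe.2 (mem_halfLinks.2 he))
  rcases hy with h0 | hc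
  · obtain ⟨h1, h2⟩ := inHalf_cT_links h4 hij h0
    simp only [crossT, h0, ↓reduceIte, cT, hUV' _ h1, hUV' _ h2]
  · have h0 : kd i j y ≠ 0 := fun h => cc_ne_zero h4 (hc.symm.trans h)
    obtain ⟨h1, h2⟩ := inHalf_dT_links h4 hij hc
    simp only [crossT, if_neg h0, dT, hUV' _ h1, hUV' _ h2]

/-- The crossing transport is measurable. -/
theorem measurable_crossT [MeasurableSpace G] [MeasurableMul₂ G] (i j : Fin 2) (y : Site 2 L) :
    Measurable fun U : GaugeConfig 2 L G => crossT i j U y := by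
  unfold crossT
  split_ifs
  · exact measurable_cT i j y
  · exact measurable_dT i j y

end CrossT

/-! ## The Gram coefficients of the crossing layers -/

section Coeff

variable {L N : ℕ} {G : Type*} [Group G] [TopologicalSpace G] [IsTopologicalGroup G]
  [CompactSpace G] (ρ : G →* Matrix (Fin N) (Fin N) ℂ)

/-- The index set of the Gram expansion: (base site, matrix entry, term/conjugate term). -/
abbrev GramIndex (L N : ℕ) : Type := Site 2 L × Fin N × Fin N × Bool

/-- The Gram coefficient functions `a_ι`: the coefficients of the crossing transport at `y` if
`y` lies on the mirror or on the back layer, zero otherwise. -/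
def gcoeff (i j : Fin 2) (hρ : Continuous ρ) (β : ℝ) (ι : GramIndex L N) (U : GaugeConfig 2 L G) : ℂ :=
  if kd i j ι.1 = 0 ∨ kd i j ι.1 = cc L then gterm ρ hρ β (crossT i j U ι.1) ι.2 else 0

/-- The coefficient functions are bounded by `√(β/2)`. -/
theorem norm_gcoeff_le {i j : Fin 2} (hρ : Continuous ρ) (β : ℝ) (ι : GramIndex L N)
    (U : GaugeConfig 2 L G) : ‖gcoeff ρ i j hρ β ι U‖ ≤ Real.sqrt (β / 2) := by
  unfold gcoeff
  split_ifs
  · exact norm_gterm_le ρ hρ β _ _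
  · rw [norm_zero]; exact Real.sqrt_nonneg _

/-- **The untwisted crossing weight is a Gram kernel**:
`Σ_ι a_ι(U) conj a_ι(Θ'U) = β (Σ_{k(y)=0} r_y(U) + Σ_{k(y)=c} r_y(U))` (`β ≥ 0`, `L ≥ 4` even). -/
theorem sum_gcoeff_mul_conj [NeZero L] (hL : Even L) (h4 : 4 ≤ L) {i j : Fin 2} (hij : i ≠ j)
    (hρ : Continuous ρ) {β : ℝ} (hβ : 0 ≤ β) (U : GaugeConfig 2 L G) :
    ∑ ι, gcoeff ρ i j hρ β ι U * (starRingEnd ℂ) (gcoeff ρ i j hρ β ι (configTwistSwap i j U)) =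
      ((β * (∑ y ∈ S0 i j, rr ρ i j U y + ∑ y ∈ Sc i j, rr ρ i j U y) : ℝ) : ℂ) := by
  classical
  have hc0 : cc L ≠ 0 := cc_ne_zero h4
  have hc0' : (0 : ZMod L) ≠ cc L := fun h => hc0 h.symm
  -- the per-site identity
  have hy : ∀ y : Site 2 L,
      ∑ k : Fin N × Fin N × Bool, gcoeff ρ i j hρ β (y, k) U *
          (starRingEnd ℂ) (gcoeff ρ i j hρ β (y, k) (configTwistSwap i j U)) =
        (((if kd i j y = 0 then β * rr ρ i j U y else 0) +
            (if kd i j y = cc L then β * rr ρ i j U y else 0) : ℝ) : ℂ) := by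
    intro y
    by_cases h0 : kd i j y = 0
    · have h1 : cT i j (configTwistSwap i j U) y = dT i j U y :=
        cT_configTwistSwap_of_kd_eq_zero h4 hij U h0
      simp only [gcoeff, crossT, h0, hc0', true_or, ↓reduceIte, add_zero, h1]
      rw [sum_gterm_mul_conj ρ hρ hβ, rr]
    · by_cases hc : kd i j y = cc L
      · have h1 : dT i j (configTwistSwap i j U) y = cT i j U y :=
          dT_configTwistSwap_of_kd_eq_cc hL hij U hc
        simp only [gcoeff, crossT, hc, hc0, or_true, ↓reduceIte, zero_add, h1]
        rw [sum_gterm_mul_conj ρ hρ hβ, rr, ← CompactGroup.re_trace_map_inv ρ hρ, mul_inv_rev,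
          inv_inv]
      · simp only [gcoeff, h0, hc, or_self, ↓reduceIte, zero_mul, Finset.sum_const_zero, add_zero,
          Complex.ofReal_zero]
  rw [Fintype.sum_prod_type]
  simp_rw [hy]
  rw [← Complex.ofReal_sum, Finset.sum_add_distrib, ← Finset.sum_filter, ← Finset.sum_filter,
    ← Finset.mul_sum, ← Finset.mul_sum, ← mul_add]
  congr 3
  · refine Finset.sum_congr (Finset.ext fun y => ?_) fun _ _ => rfl
    rw [Finset.mem_filter, mem_S0, kd_eq_zero_iff]; simp
  · refine Finset.sum_congr (Finset.ext fun y => ?_) fun _ _ => rfl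
    rw [Finset.mem_filter, mem_Sc, kd_eq_cc_iff h4]; simp

/-- The coefficient functions read only links of the closed half. -/
theorem dependsOn_gcoeff [NeZero L] (h4 : 4 ≤ L) {i j : Fin 2} (hij : i ≠ j) (hρ : Continuous ρ)
    (β : ℝ) (ι : GramIndex L N) :
    DependsOn (gcoeff ρ i j hρ β ι) (halfLinks (L := L) i j : Set (Edge 2 L)) := by
  intro U V hUV
  unfold gcoeff
  split_ifs with h
  · exact congrArg (fun g => gterm ρ hρ β g ι.2) (dependsOn_crossT h4 hij h hUV)
  · rfl

variable [MeasurableSpace G] [BorelSpace G] [SecondCountableTopology G]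

/-- The coefficient functions are measurable. -/
theorem measurable_gcoeff (i j : Fin 2) (hρ : Continuous ρ) (β : ℝ) (ι : GramIndex L N) :
    Measurable (gcoeff (G := G) ρ i j hρ β ι) := by
  unfold gcoeff
  split_ifs
  · exact (measurable_gterm ρ hρ β ι.2).comp (measurable_crossT i j ι.1)
  · exact measurable_const

end Coeff

/-! ## The positive-side observable and the abstract RP step -/

section Abstract

variable {L N : ℕ} [NeZero L] {G : Type*} [Group G] [TopologicalSpace G] [IsTopologicalGroup G]
  [CompactSpace G] [MeasurableSpace G] [BorelSpace G] [SecondCountableTopology G]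
  (ρ : G →* Matrix (Fin N) (Fin N) ℂ)

/-- `g = F · exp(β Σ_{0<k<c} r_y)`: the observable times the interior Boltzmann weight of the
closed half. -/
def gObs (i j : Fin 2) (β : ℝ) (F : GaugeConfig 2 L G → ℂ) (U : GaugeConfig 2 L G) : ℂ :=
  F U * (Real.exp (β * ∑ y ∈ Sp i j, rr ρ i j U y) : ℂ)

omit [CompactSpace G] in
/-- `g` is measurable. -/
theorem measurable_gObs (i j : Fin 2) (hρ : Continuous ρ) (β : ℝ) {F : GaugeConfig 2 L G → ℂ}
    (hF : Measurable F) : Measurable (gObs ρ i j β F) :=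
  hF.mul (Complex.measurable_ofReal.comp
    ((Finset.measurable_sum _ fun y _ => measurable_rr ρ hρ i j y).const_mul β).exp)

omit [MeasurableSpace G] [BorelSpace G] [SecondCountableTopology G] in
/-- `g` is bounded. -/
theorem norm_gObs_le (i j : Fin 2) (hρ : Continuous ρ) (β : ℝ) {F : GaugeConfig 2 L G → ℂ} {CF : ℝ}
    (hFb : ∀ U, ‖F U‖ ≤ CF) (U : GaugeConfig 2 L G) :
    ‖gObs ρ i j β F U‖ ≤ CF * Real.exp (|β| * ((Sp (L := L) i j).card * N)) := by
  unfold gObs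
  rw [norm_mul, Complex.norm_real, Real.norm_eq_abs, abs_of_pos (Real.exp_pos _)]
  refine mul_le_mul (hFb U) (Real.exp_le_exp.2 ?_) (Real.exp_pos _).le
    ((norm_nonneg _).trans (hFb U))
  calc β * ∑ y ∈ Sp i j, rr ρ i j U y ≤ |β * ∑ y ∈ Sp i j, rr ρ i j U y| := le_abs_self _
    _ = |β| * |∑ y ∈ Sp i j, rr ρ i j U y| := abs_mul _ _
    _ ≤ |β| * ((Sp (L := L) i j).card * N) :=
        mul_le_mul_of_nonneg_left (abs_sum_rr_le ρ hρ i j _ U) (abs_nonneg β)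

omit [TopologicalSpace G] [IsTopologicalGroup G] [CompactSpace G] [MeasurableSpace G] [BorelSpace G]
  [SecondCountableTopology G] in
/-- `g` reads only links of the closed half. -/
theorem dependsOn_gObs (h4 : 4 ≤ L) {i j : Fin 2} (hij : i ≠ j) (β : ℝ) {F : GaugeConfig 2 L G → ℂ}
    (hFH : IsDiagonalHalfObservable i j F) :
    DependsOn (gObs ρ i j β F) (halfLinks (L := L) i j : Set (Edge 2 L)) := by
  intro U V hUV
  have hF : F U = F V := dependsOn_halfLinks hFH hUV
  have hS : ∑ y ∈ Sp i j, rr ρ i j U y = ∑ y ∈ Sp i j, rr ρ i j V y :=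
    dependsOn_sum_rr ρ i j (Sp i j) fun e he => hUV e (by
      obtain ⟨y, hy, hey⟩ := Finset.mem_biUnion.1 he
      exact Finset.mem_coe.2 (mem_halfLinks.2 (inHalf_blk h4 hij hy hey)))
  simp only [gObs, hF, hS]

/-- **The untwisted Osterwalder–Seiler inequality**: for the TWISTED swap `Θ'`,
`0 ≤ ∫ g(U) conj g(Θ'U) exp(Σ_ι a_ι(U) conj a_ι(Θ'U)) dU` for every bounded measurable
observable `F` of the closed diagonal half (`L ≥ 4` even; product Haar measure `dU`; no sign
condition on `β` is needed for THIS inequality — `β ≥ 0` enters only through the identification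
of the exponential with the crossing Boltzmann weight, `sum_gcoeff_mul_conj`). -/
theorem integral_twisted_nonneg (hL : Even L) (h4 : 4 ≤ L) {i j : Fin 2} (hij : i ≠ j)
    (hρ : Continuous ρ) (β : ℝ) {F : GaugeConfig 2 L G → ℂ} (hF : Measurable F)
    {CF : ℝ} (hFb : ∀ U, ‖F U‖ ≤ CF) (hFH : IsDiagonalHalfObservable i j F) :
    0 ≤ ∫ U, gObs ρ i j β F U * (starRingEnd ℂ) (gObs ρ i j β F (configTwistSwap i j U)) *
        Complex.exp (∑ ι, gcoeff ρ i j hρ β ι U *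
          (starRingEnd ℂ) (gcoeff ρ i j hρ β ι (configTwistSwap i j U))) ∂(linkMeasure L G) := by
  classical
  have key := LatticeRP.integral_mul_conj_mul_exp_nonneg (haarProbability G)
    (halfLinks (L := L) i j) ∅ (configTwistSwap (G := G) i j)
    (measurePreserving_configTwistSwap hL i j)
    (fun e he => by
      rw [Finset.union_empty] at he
      exact dependsOn_configTwistSwap_apply hL h4 hij he)
    (measurable_gObs ρ i j hρ β hF) (fun ι => measurable_gcoeff ρ i j hρ β ι)
    (norm_gObs_le ρ i j hρ β hFb) (fun ι U => norm_gcoeff_le ρ hρ β ι U)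
    (by rw [Finset.union_empty]; exact dependsOn_gObs ρ h4 hij β hFH)
    (fun ι => by rw [Finset.union_empty]; exact dependsOn_gcoeff ρ h4 hij hρ β ι)
  have hsp : ∀ p : GaugeConfig 2 L G × GaugeConfig 2 L G, LatticeRP.splice ∅ p = p.1 := fun p => by
    rw [LatticeRP.splice_eq_piecewise, Finset.piecewise_empty]
  simp only [hsp] at key
  rw [integral_fun_fst (fun U : GaugeConfig 2 L G => gObs ρ i j β F U *
      (starRingEnd ℂ) (gObs ρ i j β F (configTwistSwap i j U)) *
      Complex.exp (∑ ι, gcoeff ρ i j hρ β ι U *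
        (starRingEnd ℂ) (gcoeff ρ i j hρ β ι (configTwistSwap i j U)))),
    probReal_univ, one_smul] at key
  exact key

end Abstract

end DiagRPTwo

end

end Summit.QuantumFields.GaugeBoot
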